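import Summits.CriticalPhenomena.PercolationContinuityZ3.Theorems.Transplant.CayleyCylinderShort
import Mathlib.GroupTheory.Nilpotent
import HarnessLib

/-!
# Class-3 commutator identities and unit-box words for commutators (letters-only nilpotent groups, I)

builds on p205010 (kernel theorem, internal audit signed; external expert review pending).
Lane `prim-bschramm`, seat `prim-bschramm-p4` gen 11 (PART C3 of `P4-GENERAL.md`, "thick frames").  Helper file
(`--supports stmt-CriticalPhenomena-4575 --as helper`).

Tools for the connected-cylinder criterion of `CayleySign₂` (file `CayleySkeletonConn`) in nilpotent groups of class `≤ 3`:
(§1) the class-3 identities `⁅a⁻¹,u⁆ = ⁅a,u⁆⁻¹ = ⁅a,u⁻¹⁆` and `⁅a, g u g⁻¹⁆ = ⁅a,u⁆` for `u ∈ γ₂` (`γ₃` central);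
(§2) unit-box words: the 4-step word of `⁅b,c⁆` (heights `0, φb, φb+φc, φc`), hence `⁅b,c⁆ ∈ K₁` (joined to `1` inside `‖φ‖_∞ ≤ 1`) when
`φb + φc` lies in the unit box, and the word of `⁅a⁻¹, ⁅b,c⁆⁆`, inside the unit box whenever `φa, φb, φc, φb+φc` lie in the positive unit
square.  Sequel: `CayleySkeletonClassThree` (every kernel element of a class-3 letters-only group is joined to `1` inside `C_1`; the free
nilpotent groups `N_{m+2,3}`).
-/

noncomputable section

namespace Summit.CriticalPhenomena.PercolationContinuityZ3.Theorems.Transplant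

open SimpleGraph Walk Literature.Probability.LatticeModels Literature.Probability.Percolation
open scoped Classical commutatorElement

namespace CayCyl

variable {Γ : Type} [Group Γ] {S : Finset Γ}

/-! ## §1 Class-3 commutator identities -/

/-- `⁅a, u⁆ ∈ γ₃` for `u ∈ γ₂`. [folklore] -/
theorem comm_mem_lcs_two {u : Γ} (hu : u ∈ (⊤ : Subgroup Γ).lowerCentralSeries 1) (a : Γ) :
    ⁅a, u⁆ ∈ (⊤ : Subgroup Γ).lowerCentralSeries 2 := by
  rw [Subgroup.lowerCentralSeries_succ, ← commutatorElement_inv, inv_mem_iff]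
  exact Subgroup.commutator_mem_commutator hu (Subgroup.mem_top a)

section ClassThree

variable (h3 : (⊤ : Subgroup Γ).lowerCentralSeries 3 = ⊥)
include h3

/-- In class `≤ 3`, `γ₃` is central. [folklore] -/
theorem central_of_mem_lcs_two {z : Γ} (hz : z ∈ (⊤ : Subgroup Γ).lowerCentralSeries 2) (g : Γ) : z * g = g * z := by
  have h : ⁅z, g⁆ ∈ (⊤ : Subgroup Γ).lowerCentralSeries 3 := by
    rw [Subgroup.lowerCentralSeries_succ]
    exact Subgroup.commutator_mem_commutator hz (Subgroup.mem_top g)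
  rw [h3, Subgroup.mem_bot, commutatorElement_def] at h
  calc z * g = z * g * z⁻¹ * g⁻¹ * g * z := by group
    _ = g * z := by rw [h, one_mul]

/-- **`⁅a⁻¹, u⁆ = ⁅a, u⁆⁻¹`** for `u ∈ γ₂` in class `≤ 3`. [folklore] -/
theorem comm_inv_left {u : Γ} (hu : u ∈ (⊤ : Subgroup Γ).lowerCentralSeries 1) (a : Γ) : ⁅a⁻¹, u⁆ = ⁅a, u⁆⁻¹ := by
  have hc := central_of_mem_lcs_two h3 (comm_mem_lcs_two hu a)
  have e : ⁅a⁻¹, u⁆ = a⁻¹ * ⁅a, u⁆⁻¹ * a := by simp only [commutatorElement_def]; group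
  have hc' : ⁅a, u⁆⁻¹ * a = a * ⁅a, u⁆⁻¹ := by
    have := hc a⁻¹
    calc ⁅a, u⁆⁻¹ * a = ⁅a, u⁆⁻¹ * (a * ⁅a, u⁆) * ⁅a, u⁆⁻¹ := by group
      _ = ⁅a, u⁆⁻¹ * (⁅a, u⁆ * a) * ⁅a, u⁆⁻¹ := by rw [hc a]
      _ = a * ⁅a, u⁆⁻¹ := by group
  rw [e, mul_assoc, hc', ← mul_assoc, inv_mul_cancel, one_mul]

/-- **`⁅a, u⁻¹⁆ = ⁅a, u⁆⁻¹`** for `u ∈ γ₂` in class `≤ 3`. [folklore] -/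
theorem comm_inv_right {u : Γ} (hu : u ∈ (⊤ : Subgroup Γ).lowerCentralSeries 1) (a : Γ) : ⁅a, u⁻¹⁆ = ⁅a, u⁆⁻¹ := by
  have hc := central_of_mem_lcs_two h3 (comm_mem_lcs_two hu a)
  have e : ⁅a, u⁻¹⁆ = u⁻¹ * ⁅a, u⁆⁻¹ * u := by simp only [commutatorElement_def]; group
  rw [e, mul_assoc, show ⁅a, u⁆⁻¹ * u = u * ⁅a, u⁆⁻¹ from ?_, ← mul_assoc, inv_mul_cancel, one_mul]
  calc ⁅a, u⁆⁻¹ * u = ⁅a, u⁆⁻¹ * (u * ⁅a, u⁆) * ⁅a, u⁆⁻¹ := by group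
    _ = ⁅a, u⁆⁻¹ * (⁅a, u⁆ * u) * ⁅a, u⁆⁻¹ := by rw [hc u]
    _ = u * ⁅a, u⁆⁻¹ := by group

/-- **`⁅a, g u g⁻¹⁆ = ⁅a, u⁆`** for `u ∈ γ₂` in class `≤ 3` (conjugation changes `u` by a central element). [folklore] -/
theorem comm_conj_right {u : Γ} (hu : u ∈ (⊤ : Subgroup Γ).lowerCentralSeries 1) (a g : Γ) : ⁅a, g * u * g⁻¹⁆ = ⁅a, u⁆ := by
  have hz : ⁅g, u⁆ ∈ (⊤ : Subgroup Γ).lowerCentralSeries 2 := comm_mem_lcs_two hu g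
  have hc := central_of_mem_lcs_two h3 hz
  have e : g * u * g⁻¹ = ⁅g, u⁆ * u := by simp only [commutatorElement_def]; group
  rw [e, commutatorElement_def, commutatorElement_def, mul_inv_rev]
  -- `a (z u) a⁻¹ u⁻¹ z⁻¹ = a u a⁻¹ u⁻¹` with `z` central
  calc a * (⁅g, u⁆ * u) * a⁻¹ * (u⁻¹ * ⁅g, u⁆⁻¹) = (a * ⁅g, u⁆) * u * a⁻¹ * u⁻¹ * ⁅g, u⁆⁻¹ := by group
    _ = (⁅g, u⁆ * a) * u * a⁻¹ * u⁻¹ * ⁅g, u⁆⁻¹ := by rw [hc a]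
    _ = ⁅g, u⁆ * (a * u * a⁻¹ * u⁻¹) * ⁅g, u⁆⁻¹ := by group
    _ = (a * u * a⁻¹ * u⁻¹) * ⁅g, u⁆ * ⁅g, u⁆⁻¹ := by rw [← hc (a * u * a⁻¹ * u⁻¹), mul_assoc]
    _ = a * u * a⁻¹ * u⁻¹ := by group

end ClassThree

/-! ## §2 Box-1 words for commutators -/

namespace CylBase

variable (B : CylBase Γ S)

/-- In the positive unit square: `0 ≤ v i ≤ 1`. [folklore] -/
def NN (v : Site 2) : Prop := ∀ i : Fin 2, 0 ≤ v i ∧ v i ≤ 1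

/-- The set of kernel elements joined to `1` inside `‖φ‖_∞ ≤ 1`. [folklore] -/
def K₁ (B : CylBase Γ S) : Set Γ := {k | B.φ k = 0 ∧ ∃ w : (mulCayley (S : Set Γ)).Walk (1 : Γ) k, B.InBox 1 w}

/-- A right step `g → g a` for a letter `a ∈ S`, as a walk (of length `≤ 1`; trivial if `a = 1`). [folklore] -/
def stepWalk {a : Γ} (ha : a ∈ S) (g : Γ) : (mulCayley (S : Set Γ)).Walk g (g * a) :=
  if h : a = 1 then (Walk.nil : (mulCayley (S : Set Γ)).Walk g g).copy rfl (by rw [h, mul_one])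
  else Walk.cons (adj_mul_of_mem S (Or.inl ha) h g) Walk.nil

/-- The support of a step walk. [folklore] -/
theorem support_stepWalk {a : Γ} (ha : a ∈ S) (g : Γ) {z : Γ} (hz : z ∈ (stepWalk (S := S) ha g).support) : z = g ∨ z = g * a := by
  unfold stepWalk at hz
  split_ifs at hz with h
  · rw [support_copy, support_nil, List.mem_singleton] at hz; exact Or.inl hz
  · rw [support_cons, support_nil, List.mem_cons, List.mem_singleton] at hz; exact hz

/-- A right step by `a⁻¹`. [folklore] -/
def stepWalkInv {a : Γ} (ha : a ∈ S) (g : Γ) : (mulCayley (S : Set Γ)).Walk g (g * a⁻¹) :=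
  if h : a = 1 then (Walk.nil : (mulCayley (S : Set Γ)).Walk g g).copy rfl (by rw [h, inv_one, mul_one])
  else Walk.cons (adj_mul_of_mem S (Or.inr (by rw [inv_inv]; exact ha)) (inv_ne_one.2 h) g) Walk.nil

/-- The support of an inverse step walk. [folklore] -/
theorem support_stepWalkInv {a : Γ} (ha : a ∈ S) (g : Γ) {z : Γ} (hz : z ∈ (stepWalkInv (S := S) ha g).support) :
    z = g ∨ z = g * a⁻¹ := by
  unfold stepWalkInv at hz
  split_ifs at hz with h
  · rw [support_copy, support_nil, List.mem_singleton] at hz; exact Or.inl hz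
  · rw [support_cons, support_nil, List.mem_cons, List.mem_singleton] at hz; exact hz

/-- **The 4-step word of `⁅b, c⁆`** `1 → b → bc → bcb⁻¹ → bcb⁻¹c⁻¹`: heights `0, φb, φb+φc, φc`. [folklore] -/
theorem exists_walk_comm {b c : Γ} (hb : b ∈ S) (hc : c ∈ S) :
    ∃ w : (mulCayley (S : Set Γ)).Walk (1 : Γ) ⁅b, c⁆,
      ∀ z ∈ w.support, B.φ z = 0 ∨ B.φ z = B.φ b ∨ B.φ z = B.φ b + B.φ c ∨ B.φ z = B.φ c := by
  refine ⟨(((stepWalk hb 1).append (stepWalk hc (1 * b))).append (stepWalkInv hb (1 * b * c))).append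
    ((stepWalkInv hc (1 * b * c * b⁻¹)).copy rfl (by rw [commutatorElement_def, one_mul])), fun z hz => ?_⟩
  have h1 := B.φ_one
  simp only [support_append, support_copy, List.mem_append] at hz
  rcases hz with ((hz | hz) | hz) | hz
  · rcases support_stepWalk hb 1 hz with rfl | rfl
    · exact Or.inl h1
    · rw [one_mul]; exact Or.inr (Or.inl rfl)
  · rcases support_stepWalk hc (1 * b) (List.tail_subset _ hz) with rfl | rfl
    · rw [one_mul]; exact Or.inr (Or.inl rfl)
    · rw [one_mul, B.map_mul]; exact Or.inr (Or.inr (Or.inl rfl))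
  · rcases support_stepWalkInv hb (1 * b * c) (List.tail_subset _ hz) with rfl | rfl
    · rw [one_mul, B.map_mul]; exact Or.inr (Or.inr (Or.inl rfl))
    · rw [one_mul, B.map_mul, B.map_mul, B.φ_inv]; exact Or.inr (Or.inr (Or.inr (by abel)))
  · rcases support_stepWalkInv hc (1 * b * c * b⁻¹) (List.tail_subset _ hz) with rfl | rfl
    · rw [one_mul, B.map_mul, B.map_mul, B.φ_inv]; exact Or.inr (Or.inr (Or.inr (by abel)))
    · rw [one_mul, B.map_mul, B.map_mul, B.map_mul, B.φ_inv, B.φ_inv]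
      exact Or.inl (by abel)

/-- `⁅b, c⁆ ∈ K₁` when `φb + φc ∈ box 1` (and the letters have unit range). [folklore] -/
theorem comm_mem_K₁ {b c : Γ} (hb : b ∈ S) (hc : c ∈ S) (hbc : B.φ b + B.φ c ∈ box 2 1) : ⁅b, c⁆ ∈ B.K₁ := by
  have hb1 : B.φ b ∈ box 2 1 := by rw [mem_box]; intro i; have := B.lip b hb i; rw [abs_le] at this; exact this
  have hc1 : B.φ c ∈ box 2 1 := by rw [mem_box]; intro i; have := B.lip c hc i; rw [abs_le] at this; exact this
  obtain ⟨w, hw⟩ := B.exists_walk_comm hb hc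
  refine ⟨by rw [commutatorElement_def, B.map_mul, B.map_mul, B.map_mul, B.φ_inv, B.φ_inv]; abel, w, fun z hz => ?_⟩
  rcases hw z hz with h | h | h | h <;> rw [h]
  · exact zero_mem_box 2 1
  · exact hb1
  · exact hbc
  · exact hc1

/-- **The word of `⁅a⁻¹, ⁅b, c⁆⁆` stays in the unit box when `φa, φb, φc, φb + φc` lie in the positive unit square.** [folklore] -/
theorem comm₃_mem_K₁ {a b c : Γ} (ha : a ∈ S) (hb : b ∈ S) (hc : c ∈ S) (hna : NN (B.φ a)) (hnb : NN (B.φ b))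
    (hnc : NN (B.φ c)) (hnbc : NN (B.φ b + B.φ c)) : ⁅a⁻¹, ⁅b, c⁆⁆ ∈ B.K₁ := by
  set t : Γ := ⁅b, c⁆ with ht
  have h1 := B.φ_one
  have hφt : B.φ t = 0 := by rw [ht, commutatorElement_def, B.map_mul, B.map_mul, B.map_mul, B.φ_inv, B.φ_inv]; abel
  obtain ⟨wt, hwt⟩ := B.exists_walk_comm hb hc
  -- the word: `1 → a⁻¹ → a⁻¹ t → a⁻¹ t a → a⁻¹ t a t⁻¹`
  let w₁ : (mulCayley (S : Set Γ)).Walk (1 : Γ) (1 * a⁻¹) := stepWalkInv ha 1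
  let w₂ : (mulCayley (S : Set Γ)).Walk (1 * a⁻¹) (1 * a⁻¹ * t) := (lmul S (1 * a⁻¹) wt).copy (mul_one _) rfl
  let w₃ : (mulCayley (S : Set Γ)).Walk (1 * a⁻¹ * t) (1 * a⁻¹ * t * a) := stepWalk ha _
  let w₄ : (mulCayley (S : Set Γ)).Walk (1 * a⁻¹ * t * a) (1 * a⁻¹ * t * a * t⁻¹) :=
    (lmul S (1 * a⁻¹ * t * a * t⁻¹) wt.reverse).copy (by rw [mul_assoc _ t⁻¹ t, inv_mul_cancel, mul_one]) (mul_one _)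
  have hφ3 : B.φ (1 * a⁻¹ * t * a * t⁻¹) = 0 := by
    simp only [one_mul, B.map_mul, B.φ_inv, hφt, neg_zero, add_zero]; abel
  refine ⟨by rw [commutatorElement_def, inv_inv, ← one_mul (a⁻¹ * t * a * t⁻¹), ← mul_assoc, ← mul_assoc, ← mul_assoc]; exact hφ3,
    (w₁.append (w₂.append (w₃.append w₄))).copy rfl (by rw [commutatorElement_def a⁻¹ t, inv_inv, one_mul]), fun z hz => ?_⟩
  have A0 := hna 0; have A1 := hna 1; have B0 := hnb 0; have B1 := hnb 1; have C0 := hnc 0; have C1 := hnc 1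
  have D0 := hnbc 0; have D1 := hnbc 1
  simp only [Pi.add_apply] at D0 D1
  have key : ∀ v : Site 2, (v = 0 ∨ v = B.φ b ∨ v = B.φ b + B.φ c ∨ v = B.φ c) →
      (-B.φ a + v ∈ box 2 1 ∧ v ∈ box 2 1) := by
    intro v hv
    rw [mem_box, mem_box, Fin.forall_fin_two, Fin.forall_fin_two]
    simp only [Pi.add_apply, Pi.neg_apply]
    rcases hv with rfl | rfl | rfl | rfl
    · simp only [Pi.zero_apply]; omega
    · omega
    · simp only [Pi.add_apply]; omega
    · omega
  simp only [w₁, w₂, w₃, w₄, support_copy, Walk.mem_support_append_iff] at hz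
  rcases hz with hz | hz | hz | hz
  · rcases support_stepWalkInv ha 1 hz with rfl | rfl
    · rw [h1]; exact zero_mem_box 2 1
    · rw [one_mul, B.φ_inv]; have := (key 0 (Or.inl rfl)).1; rwa [add_zero] at this
  · obtain ⟨z', hz', rfl⟩ := mem_support_lmul.1 hz
    rw [B.map_mul, one_mul, B.φ_inv]
    exact (key _ (hwt z' hz')).1
  · rcases support_stepWalk ha _ hz with rfl | rfl
    · rw [one_mul, B.map_mul, B.φ_inv, hφt]; exact (key 0 (Or.inl rfl)).1
    · rw [one_mul, B.map_mul, B.map_mul, B.φ_inv, hφt, add_zero, neg_add_cancel]; exact zero_mem_box 2 1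
  · obtain ⟨z', hz', rfl⟩ := mem_support_lmul.1 hz
    rw [support_reverse, List.mem_reverse] at hz'
    rw [B.map_mul, hφ3, zero_add]
    exact (key _ (hwt z' hz')).2

end CylBase

end CayCyl

end Summit.CriticalPhenomena.PercolationContinuityZ3.Theorems.Transplant

end
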